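import Mathlib.FieldTheory.Differential.Liouville
import HarnessLib

/-!
# Descent of logarithmic-derivative identities along finite extensions (Galois averaging)

Trunk T-TRANSCEND (`Literature/NumberTheory/Transcendental`). Support for the transcendence
input of Ax's theorem (M. Rosenlicht, *On Liouville's theory of elementary functions*, Pacific
J. Math. 65 (1976), proof of Prop. 4: "we may replace `K` by a finite normal extension … apply
the trace"; the same averaging is Rosenlicht's 1972 proof of Liouville's theorem, formalised in
Mathlib as `isLiouville_of_finiteDimensional`).

Mathlib's `IsLiouville F K` records that an identity `a = ∑ cᵢ · uᵢ′/uᵢ + v′` (`a, cᵢ ∈ F`,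
`uᵢ, v ∈ K`) descends to `F`, but forgets the coefficients. For Ax's theorem the coefficients
matter (they are `ℚ`-linearly independent constants), so we re-prove the descent keeping them,
at the price of an integer factor `N = [E : F]` (`E` a normal closure):
`N · a = ∑ cᵢ · u₀ᵢ′/u₀ᵢ + v₀′` with `u₀ᵢ, v₀ ∈ F` (`u₀ᵢ = N_{E/F}(uᵢ)`, `v₀ = Tr_{E/F}(v)`).
Everything here is PROVED, in Mathlib's `Differential` framework.

## References

* M. Rosenlicht, *On Liouville's theory of elementary functions*, Pacific J. Math. 65 (1976),
  485–492, proof of Prop. 4.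
* M. Rosenlicht, *Integration in finite terms*, Amer. Math. Monthly 79 (1972), 963–972
  (the averaging argument; Mathlib `isLiouville_of_finiteDimensional`).
-/

noncomputable section

open scoped Differential
open Differential IntermediateField Finset Polynomial

namespace Literature.NumberTheory.Transcendental

section Galois

variable {F K : Type*} [Field F] [Field K] [Differential F] [Differential K] [CharZero F]
  [Algebra F K] [DifferentialAlgebra F K]

omit [CharZero F] in
/-- An `F`-automorphism of a separable differential extension commutes with logarithmic
derivatives. [folklore] -/
theorem algEquiv_logDeriv [Algebra.IsSeparable F K] (σ : K ≃ₐ[F] K) (x : K) :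
    σ (logDeriv x) = logDeriv (σ x) := by
  unfold logDeriv
  rw [map_div₀, algEquiv_deriv']

/-- **Galois averaging** (Rosenlicht). Let `K/F` be a finite Galois extension of differential
fields of characteristic zero, `N = [K : F]`. If `a ∈ F` satisfies `a = ∑ cᵢ · uᵢ′/uᵢ + v′` with
`cᵢ ∈ F`, `0 ≠ uᵢ ∈ K`, `v ∈ K`, then `N a = ∑ cᵢ · u₀ᵢ′/u₀ᵢ + v₀′` with `0 ≠ u₀ᵢ ∈ F`
(the norms `∏_σ σuᵢ`) and `v₀ ∈ F` (the trace `∑_σ σv`): sum the conjugates of the identity.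
[cite: Rosenlicht1976, Prop. 4 (proof)] -/
theorem exists_nat_mul_eq_sum_logDeriv_of_isGalois [FiniteDimensional F K] [IsGalois F K]
    (a : F) {ι : Type*} [Fintype ι] (c : ι → F) (u : ι → K) (hu : ∀ i, u i ≠ 0) (v : K)
    (h : algebraMap F K a = ∑ i, algebraMap F K (c i) * logDeriv (u i) + v′) :
    ∃ N : ℕ, N ≠ 0 ∧ ∃ (u₀ : ι → F) (v₀ : F), (∀ i, u₀ i ≠ 0) ∧
      (N : F) * a = ∑ i, c i * logDeriv (u₀ i) + v₀′ := by
  classical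
  haveI : CharZero K :=
    charZero_of_injective_algebraMap (FaithfulSMul.algebraMap_injective F K)
  set G := K ≃ₐ[F] K
  -- norms and traces
  let u₁ : ι → K := fun i => ∏ σ : G, σ (u i)
  have hu₁ : ∀ i, u₁ i ∈ fixedField (⊤ : Subgroup G) := by
    rintro i ⟨e, _⟩
    change e (u₁ i) = u₁ i
    simp only [u₁, map_prod]
    exact Fintype.prod_equiv (Equiv.mulLeft e) _ _ fun σ => rfl
  have ffb : fixedField (⊤ : Subgroup G) = ⊥ :=
    (IsGalois.tfae.out 0 1).mp (inferInstance : IsGalois F K)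
  simp_rw [ffb, IntermediateField.mem_bot, Set.mem_range] at hu₁
  choose u₀ hu₀ using hu₁
  let v₁ : K := ∑ σ : G, σ v
  have hv₁ : v₁ ∈ fixedField (⊤ : Subgroup G) := by
    rintro ⟨e, _⟩
    change e v₁ = v₁
    simp only [v₁, map_sum]
    exact Fintype.sum_equiv (Equiv.mulLeft e) _ _ fun σ => rfl
  rw [ffb, IntermediateField.mem_bot] at hv₁
  obtain ⟨v₀, hv₀⟩ := hv₁
  have hu₁ne : ∀ i, u₁ i ≠ 0 := fun i =>
    Finset.prod_ne_zero_iff.mpr fun σ _ => (map_ne_zero σ).mpr (hu i)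
  refine ⟨Fintype.card G, Fintype.card_ne_zero, u₀, v₀, fun i h0 => hu₁ne i ?_, ?_⟩
  · rw [← hu₀ i, h0, map_zero]
  -- the identity, in `K`
  apply FaithfulSMul.algebraMap_injective F K
  simp only [map_mul, map_natCast, map_add, map_sum, ← logDeriv_algebraMap, ← deriv_algebraMap,
    hu₀, hv₀]
  -- sum the conjugates of `h`
  have hσ : ∀ σ : G, algebraMap F K a =
      ∑ i, algebraMap F K (c i) * logDeriv (σ (u i)) + (σ v)′ := by
    intro σ
    have := congrArg σ h
    rw [AlgEquiv.commutes, map_add, map_sum, algEquiv_deriv'] at this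
    rw [this]
    congr 1
    refine Finset.sum_congr rfl fun i _ => ?_
    rw [map_mul, AlgEquiv.commutes, algEquiv_logDeriv]
  have hsum := Finset.sum_congr rfl fun (σ : G) (_ : σ ∈ Finset.univ) => hσ σ
  rw [Finset.sum_const, Finset.card_univ, nsmul_eq_mul] at hsum
  rw [hsum, Finset.sum_add_distrib, Finset.sum_comm, ← map_sum]
  congr 1
  refine Finset.sum_congr rfl fun i _ => ?_
  rw [← Finset.mul_sum, logDeriv_prod _ _ _ fun σ _ => (map_ne_zero σ).mpr (hu i)]

end Galois

section General

variable {F K : Type*} [Field F] [Field K] [Differential F] [Differential K] [CharZero F]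
  [Algebra F K] [DifferentialAlgebra F K]

/-- **Descent of a logarithmic-derivative identity along a finite extension, keeping the
coefficients** (Rosenlicht 1976, proof of Prop. 4; Rosenlicht 1972). Let `K/F` be a finite
extension of differential fields of characteristic zero. If `a ∈ F` satisfies
`a = ∑ cᵢ · uᵢ′/uᵢ + v′` with `cᵢ ∈ F`, `0 ≠ uᵢ ∈ K`, `v ∈ K`, then for some integer `N ≥ 1`
(the degree of a normal closure) `N a = ∑ cᵢ · u₀ᵢ′/u₀ᵢ + v₀′` with `0 ≠ u₀ᵢ ∈ F`, `v₀ ∈ F`.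
Proof: embed `K` in a finite Galois extension `E` of `F` (a normal closure inside an algebraic
closure, with its unique differential structure) and average over `Gal(E/F)`.
[cite: Rosenlicht1976, Prop. 4 (proof)] -/
theorem exists_nat_mul_eq_sum_logDeriv [FiniteDimensional F K] (a : F) {ι : Type*} [Fintype ι]
    (c : ι → F) (u : ι → K) (hu : ∀ i, u i ≠ 0) (v : K)
    (h : algebraMap F K a = ∑ i, algebraMap F K (c i) * logDeriv (u i) + v′) :
    ∃ N : ℕ, N ≠ 0 ∧ ∃ (u₀ : ι → F) (v₀ : F), (∀ i, u₀ i ≠ 0) ∧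
      (N : F) * a = ∑ i, c i * logDeriv (u₀ i) + v₀′ := by
  -- a normal closure `E` of (a copy `K'` of) `K` inside an algebraic closure of `F`
  let φ₀ : K →ₐ[F] AlgebraicClosure F := IsAlgClosed.lift (M := AlgebraicClosure F) (R := F) (S := K)
  let K' : IntermediateField F (AlgebraicClosure F) := φ₀.fieldRange
  haveI : FiniteDimensional F K' := LinearMap.finiteDimensional_range φ₀.toLinearMap
  let E : IntermediateField F (AlgebraicClosure F) := normalClosure F K' (AlgebraicClosure F)
  let φ : K →ₐ[F] E :=
    (IntermediateField.inclusion (IntermediateField.le_normalClosure K')).comp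
      (AlgEquiv.ofInjectiveField φ₀).toAlgHom
  have hφ : Function.Injective φ := φ.toRingHom.injective
  -- transport the identity to `E`
  have hφd : ∀ x : K, φ (x′) = (φ x)′ := fun x => algHom_deriv' φ hφ x
  have h' : algebraMap F E a = ∑ i, algebraMap F E (c i) * logDeriv (φ (u i)) + (φ v)′ := by
    have := congrArg φ h
    rw [AlgHom.commutes, map_add, map_sum, hφd] at this
    rw [this]
    congr 1
    refine Finset.sum_congr rfl fun i _ => ?_
    rw [map_mul, AlgHom.commutes]
    unfold logDeriv
    rw [map_div₀, hφd]
  exact exists_nat_mul_eq_sum_logDeriv_of_isGalois a c (fun i => φ (u i))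
    (fun i => (map_ne_zero φ).mpr (hu i)) (φ v) h'

end General

end Literature.NumberTheory.Transcendental
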